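import Literature.Analysis.FluidPDE.ClassicalSolutionCalculus
import Literature.Analysis.FluidPDE.ForwardMildWeak
import HarnessLib

/-!
# Classical solutions bounded on an open time interval are bounded weak solutions (KNSS class)

Analysis/FluidPDE support file (serves the decomposition of
`Literature.Analysis.FluidPDE.KNSS2009_regularity_bound_C_over_r`, Koch–Nadirashvili–Seregin–Šverák
2009, Thm. 6.1, whose printed proof rescales a classical solution around near-maxima — the
covariance `IsClassicalNSSolutionOn.nsRescale_translate_zero` of `ClassicalSolutionRescale` — and
passes to a limit in the class of *bounded weak solutions*, `IsBoundedWeakNSSolutionOn`). One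
elementary fact is proved here:

* `IsClassicalNSSolutionOn.isBoundedWeakNSSolutionOn` — a classical solution of the unforced
  system on `E × (a, b)` whose velocity is bounded there is a bounded weak solution on `(a, b)`
  in the sense of KNSS 2009, §4 (ii) (pair the momentum equation with a divergence-free test
  field, integrate by parts in `x` — the accepted slice identity
  `IsClassicalNSSolutionOn.integral_inner_timeDerivWithin_test`, in which the pressure drops
  out, so that no growth condition on `p` is needed — and in `t` on a compact interval
  `[a₁, b₁] ⊂ (a, b)` containing the time support of the test field; both boundary terms
  vanish). This is the open-interval, datum-free twin of the accepted
  `IsClassicalNSSolutionOn.isWeakNSSolutionOn_holds` (`ClassicalSolutionCalculus`, Leray's class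
  on `[0, T)` with the initial-datum term).

## References

* G. Koch, N. Nadirashvili, G. Seregin, V. Šverák, *Liouville theorems for the Navier–Stokes
  equations and applications*, Acta Math. 203 (2009) = arXiv:0709.3599, §4 (ii) p. 8 (bounded
  weak solutions), §6 (proof of Thm. 6.1, p. 12). [KochNadirashviliSereginSverak2009]
* J. Leray, Acta Math. 63 (1934), §III (17) (classical solutions are weak solutions). [Leray1934]
-/

noncomputable section

open MeasureTheory Set Function Filter Topology TopologicalSpace InnerProductSpace
open scoped RealInnerProductSpace Laplacian ContDiff

namespace Literature.Analysis.FluidPDE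

/-! ### Classical solutions bounded on an open time interval are bounded weak solutions -/

section BoundedWeak

variable {E : Type*} [NormedAddCommGroup E] [InnerProductSpace ℝ E] [FiniteDimensional ℝ E]
  [MeasurableSpace E] [BorelSpace E]

/-- **Classical solutions are bounded weak solutions in the sense of KNSS.** A classical
solution `(u, p)` of the unforced Navier–Stokes system on `E × (a, b)` whose velocity is bounded
on `(a, b) × E` is a bounded weak solution on `(a, b)` (`IsBoundedWeakNSSolutionOn`, KNSS 2009,
§4 (ii): `div u = 0` and `∫∫ u·(∂ₜφ + νΔφ) + u_k u·∂_k φ = 0` for all smooth compactly supported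
divergence-free `φ`): the pressure drops out against divergence-free test fields and no growth
condition on `p` is needed. Proof: the time support of a test field `ψ` on the slab lies in some
`[a', b'] ⊂ (a, b)`; on `[a₁, b₁]` with `a < a₁ < a'`, `b' < b₁ < b` the slice identity
`∫⟪∂ₜu, ψ⟫ = ∫⟪u, (u·∇)ψ⟫ + ν∫⟪u, Δψ⟫` (`integral_inner_timeDerivWithin_test`) turns the
integrand into `d/dt ∫⟪u, ψ⟫`, whose integral over `[a₁, b₁]` vanishes since
`ψ(a₁) = ψ(b₁) = 0` (Leray 1934, §III (17); KNSS 2009, §4 (ii)). [cite: KochNadirashviliSereginSverak2009, §4 (ii) (arXiv:0709.3599 p. 8)] -/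
theorem IsClassicalNSSolutionOn.isBoundedWeakNSSolutionOn {a b ν : ℝ} {u : ℝ → E → E}
    {p : ℝ → E → ℝ} (h : IsClassicalNSSolutionOn (Ioo a b) ν 0 u p)
    (hbdd : IsBoundedOn (Ioo a b) u) :
    IsBoundedWeakNSSolutionOn (Ioo a b) isOpen_Ioo ν u := by
  have hu_cont : ContinuousOn (uncurry u) (Ioo a b ×ˢ univ) := h.smooth_velocity.continuousOn
  refine ⟨?_, hbdd, ?_, ?_⟩
  · exact hu_cont.aestronglyMeasurable (measurableSet_Ioo.prod MeasurableSet.univ)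
  · exact (ae_restrict_iff' measurableSet_Ioo).2 (Eventually.of_forall fun t ht =>
      VectorCalculus.IsDivFree.isWeaklyDivFree_holds (h.divFree t ht)
        (contDiff_infty.1 (h.contDiff_velocity ht) 1))
  intro ψ hψ hdiv
  rcases le_or_gt b a with hab | hab
  · simp [Ioo_eq_empty_of_le hab]
  -- time support `[a', b'] ⊂ (a, b)` and a compact interval `[a₁, b₁]` around it
  obtain ⟨a', b', haa', ha'b', hb'b, hsupp⟩ := hψ.exists_time_support_Ioo hab
  set a₁ : ℝ := (a + a') / 2 with ha₁
  set b₁ : ℝ := (b' + b) / 2 with hb₁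
  have haa₁ : a < a₁ := by rw [ha₁]; linarith
  have ha₁a' : a₁ < a' := by rw [ha₁]; linarith
  have hb'b₁ : b' < b₁ := by rw [hb₁]; linarith
  have hb₁b : b₁ < b := by rw [hb₁]; linarith
  have ha₁b₁ : a₁ < b₁ := by linarith
  have hsub : Icc a₁ b₁ ⊆ Ioo a b := fun t ht => ⟨haa₁.trans_le ht.1, ht.2.trans_lt hb₁b⟩
  set S₀ : Set ℝ := Icc a₁ b₁ with hS₀
  have hU : UniqueDiffOn ℝ S₀ := uniqueDiffOn_Icc ha₁b₁
  have h₀ : IsClassicalNSSolutionOn S₀ ν 0 u p := h.mono hsub hU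
  have hu₀ : ContinuousOn (uncurry u) (S₀ ×ˢ univ) := h₀.smooth_velocity.continuousOn
  have hdt_cont : ContinuousOn (uncurry (timeDerivWithin S₀ u)) (S₀ ×ˢ univ) :=
    (h₀.smooth_velocity.timeDerivWithin hU).continuousOn
  -- values of `ψ` and its derived fields off the time support
  have hψ0 : ∀ t, t ∉ Icc a' b' → ∀ x, ψ t x = 0 := fun t ht x => by rw [hsupp t ht]; rfl
  have hψa₁ : ∀ x, ψ a₁ x = 0 := hψ0 a₁ fun ht => (not_le.2 ha₁a') ht.1
  have hψb₁ : ∀ x, ψ b₁ x = 0 := hψ0 b₁ fun ht => (not_le.2 hb'b₁) ht.2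
  have hzero : ∀ t, t ∉ Icc a' b' → ∀ x,
      ⟪u t x, timeDeriv ψ t x⟫ + ⟪u t x, convect (u t) (ψ t) x⟫ + ν * ⟪u t x, Δ (ψ t) x⟫ = 0 := by
    intro t ht x
    have hopen : IsOpen (Icc a' b')ᶜ := isClosed_Icc.isOpen_compl
    have hnear : (fun s => ψ s x) =ᶠ[𝓝 t] fun _ => (0 : E) :=
      Filter.eventually_of_mem (hopen.mem_nhds ht) fun s hs => hψ0 s hs x
    have h1 : timeDeriv ψ t x = 0 := by
      rw [timeDeriv_apply, hnear.deriv_eq, deriv_const]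
    have h2 : fderiv ℝ (ψ t) x = 0 := by
      rw [show ψ t = fun _ => (0 : E) from funext (hψ0 t ht), fderiv_fun_const, Pi.zero_apply]
    have h3 : Δ (ψ t) x = 0 :=
      laplacian_eq_zero_of_notMem_tsupport (by
        rw [hsupp t ht, tsupport_eq_empty_iff.2 rfl]; exact notMem_empty x)
    rw [h1, convect_apply, h2, h3]
    simp
  -- reduce the time integral to `(a₁, b₁)`
  rw [setIntegral_eq_of_subset_of_forall_sdiff_eq_zero (measurableSet_Ioo (a := a) (b := b))
    (Ioo_subset_Ioo haa₁.le hb₁b.le : Ioo a₁ b₁ ⊆ Ioo a b)]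
  swap
  · intro t ht
    have ht' : t ∉ Icc a' b' := fun h' => ht.2 ⟨ha₁a'.trans_le h'.1, h'.2.trans_lt hb'b₁⟩
    simp only [hzero t ht', integral_zero]
  -- the compact `x`-shadow of the test field
  obtain ⟨K, hK, hKt⟩ := hψ.exists_compact_slice_subset
  have hψK : ∀ t, ∀ x ∉ K, ψ t x = 0 := fun t x hx =>
    image_eq_zero_of_notMem_tsupport fun h' => hx (hKt t h')
  -- the space–time integrand `∂ₜ ⟪u, ψ⟫`
  set D : ℝ × E → ℝ := fun z => ⟪u z.1 z.2, timeDeriv ψ z.1 z.2⟫ +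
    ⟪timeDerivWithin S₀ u z.1 z.2, ψ z.1 z.2⟫ with hD
  have hDcont : ContinuousOn D (Icc a₁ b₁ ×ˢ univ) := by
    refine ContinuousOn.add (ContinuousOn.inner hu₀ hψ.continuous_timeDeriv.continuousOn)
      (ContinuousOn.inner hdt_cont ?_)
    exact hψ.contDiff.continuous.continuousOn
  have hDK : ∀ t ∈ Icc a₁ b₁, ∀ x ∉ K, D (t, x) = 0 := fun t _ x hx => by
    simp only [hD]
    rw [hψK t x hx, timeDeriv_eq_zero_of_forall (fun s => hψK s x hx)]
    simp
  have hDint := integrable_prod_of_continuousOn hK hDcont hDK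
  -- slice identity for every `t ∈ (a₁, b₁)`
  have hslice : ∀ t ∈ Ioo a₁ b₁, ∫ x, (⟪u t x, timeDeriv ψ t x⟫ + ⟪u t x, convect (u t) (ψ t) x⟫ +
      ν * ⟪u t x, (Δ (ψ t)) x⟫) = ∫ x, D (t, x) := by
    intro t ht
    have ht' : t ∈ S₀ := Ioo_subset_Icc_self ht
    have hψ2 : ContDiff ℝ 2 (ψ t) := contDiff_infty.1 (hψ.contDiff_slice t) 2
    have key := h₀.integral_inner_timeDerivWithin_test hU ht' hψ2 (hψ.hasCompactSupport_slice t)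
      (hdiv t)
    simp only [Pi.zero_apply, inner_zero_left, add_zero] at key
    have huc : Continuous (u t) := (h₀.contDiff_velocity ht').continuous
    have i1 : Integrable (fun x => ⟪u t x, timeDeriv ψ t x⟫) (volume : Measure E) :=
      integrable_inner_of_hasCompactSupport_right huc
        (hψ.continuous_timeDeriv.comp (Continuous.prodMk_right t))
        (HasCompactSupport.intro hK fun x hx => timeDeriv_eq_zero_of_forall
          (fun s => hψK s x hx) t)
    have i2 : Integrable (fun x => ⟪timeDerivWithin S₀ u t x, ψ t x⟫) (volume : Measure E) :=
      integrable_inner_of_hasCompactSupport_right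
        (((h₀.smooth_velocity.timeDerivWithin hU).contDiff_slice ht').continuous)
        (hψ.contDiff_slice t).continuous (hψ.hasCompactSupport_slice t)
    have hψ1 : ContDiff ℝ 1 (ψ t) := hψ2.of_le one_le_two
    have iC' : Integrable (fun x => ⟪u t x, convect (u t) (ψ t) x⟫) (volume : Measure E) :=
      integrable_inner_of_hasCompactSupport_right huc
        ((hψ1.continuous_fderiv one_ne_zero).clm_apply huc)
        (((hψ.hasCompactSupport_slice t).fderiv (𝕜 := ℝ)).mono fun x hx => by
          contrapose! hx; simp only [mem_support, not_not] at hx; simp [convect, hx])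
    have iL' : Integrable (fun x => ν * ⟪u t x, (Δ (ψ t)) x⟫) (volume : Measure E) :=
      (integrable_inner_of_hasCompactSupport_right huc (continuous_laplacian hψ2)
        ((hψ.hasCompactSupport_slice t).mono' fun x hx => by
          contrapose! hx; simp [laplacian_eq_zero_of_notMem_tsupport hx])).const_mul ν
    calc ∫ x, (⟪u t x, timeDeriv ψ t x⟫ + ⟪u t x, convect (u t) (ψ t) x⟫ +
          ν * ⟪u t x, (Δ (ψ t)) x⟫)
        = ∫ x, (⟪u t x, timeDeriv ψ t x⟫ + (⟪u t x, convect (u t) (ψ t) x⟫ +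
          ν * ⟪u t x, (Δ (ψ t)) x⟫)) :=
          integral_congr_ae (Eventually.of_forall fun x => by ring)
      _ = (∫ x, ⟪u t x, timeDeriv ψ t x⟫) + ∫ x, ⟪timeDerivWithin S₀ u t x, ψ t x⟫ := by
          have i3 : Integrable (fun x => ⟪u t x, convect (u t) (ψ t) x⟫ +
              ν * ⟪u t x, (Δ (ψ t)) x⟫) (volume : Measure E) := iC'.add iL'
          rw [integral_add i1 i3, key]
      _ = ∫ x, D (t, x) := (integral_add i1 i2).symm
  -- integrate the slice identity in time and swap the integrals
  have hstep : ∫ t in Ioo a₁ b₁, ∫ x, (⟪u t x, timeDeriv ψ t x⟫ + ⟪u t x, convect (u t) (ψ t) x⟫ +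
      ν * ⟪u t x, (Δ (ψ t)) x⟫) = ∫ x, ∫ t in Ioo a₁ b₁, D (t, x) := by
    rw [setIntegral_congr_fun measurableSet_Ioo hslice]
    exact integral_integral_swap (f := fun t x => D (t, x)) hDint
  -- fundamental theorem of calculus on each time line: both boundary terms vanish
  have hline : ∀ x, ∫ t in Ioo a₁ b₁, D (t, x) = 0 := by
    intro x
    have hcont : ContinuousOn (fun t => ⟪u t x, ψ t x⟫) (Icc a₁ b₁) := by
      refine ContinuousOn.inner ?_ ?_
      · exact hu₀.comp (Continuous.prodMk_left x).continuousOn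
          fun t ht => mk_mem_prod ht (mem_univ x)
      · exact (hψ.contDiff.continuous.comp (Continuous.prodMk_left x)).continuousOn
    have hderiv : ∀ t ∈ Ioo a₁ b₁, HasDerivWithinAt (fun t => ⟪u t x, ψ t x⟫) (D (t, x))
        (Ioi t) t := by
      intro t ht
      have hu' : HasDerivAt (fun s => u s x) (timeDerivWithin S₀ u t x) t :=
        (h₀.smooth_velocity.hasDerivWithinAt_timeDerivWithin hU (Ioo_subset_Icc_self ht)
          x).hasDerivAt (Icc_mem_nhds ht.1 ht.2)
      exact (hu'.inner ℝ (hψ.hasDerivAt_time t x)).hasDerivWithinAt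
    have hint : IntervalIntegrable (fun t => D (t, x)) volume a₁ b₁ := by
      refine ContinuousOn.intervalIntegrable ?_
      rw [uIcc_of_le ha₁b₁.le]
      exact hDcont.comp (Continuous.prodMk_left x).continuousOn
        fun t ht => mk_mem_prod ht (mem_univ x)
    have := intervalIntegral.integral_eq_sub_of_hasDeriv_right_of_le ha₁b₁.le hcont hderiv hint
    rw [intervalIntegral.integral_of_le ha₁b₁.le, integral_Ioc_eq_integral_Ioo] at this
    rw [this, hψa₁ x, hψb₁ x, inner_zero_right, inner_zero_right, sub_self]
  rw [hstep, integral_congr_ae (Eventually.of_forall hline), integral_zero]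

end BoundedWeak

end Literature.Analysis.FluidPDE

end
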